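import Summits.NavierStokesRegularity.NavierStokesRegularity.Theses.AxisymmetricExtremality
import Literature.Analysis.FluidPDE.LeiRenZhangSwirlWeights
import Literature.Analysis.FluidPDE.AxisymmetricVorticityTransport
import HarnessLib

/-!
# Seregin 2020, Lemma 2.2, sign audit of (2.12): the planar Gaussian `exp(-L|x'|²)` is a smooth
# bounded classical SUBsolution of `∂ₜπ + (2x'/|x'|²)·∇π - Δπ ≤ 0` off the axis

Helper toward the stub `stub_seregin2020TypeII` of the crux `AxisymmetricKatoGlobal` (= the named
fact `Literature.Analysis.FluidPDE.Seregin2020_axisymmetricSingularPoint_typeII`, G. Seregin,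
Anal. Math. Phys. 10 (2020) Paper 46 = arXiv:2006.04140, Thm 2.1). Its one remaining unproved
ingredient in the tree is Lemma 2.2 (propagation of a lower bound from the axis for the operator
`∂ₜ + (u + 2x'/|x'|²)·∇ - Δ`, after Nazarov–Uraltseva 2012, Lemma 4.2), kept as the written-out
hypothesis `hWH` of `ae_swirl_eq_zero_of_weakHarnack`. The paper prints the differential
inequality (2.12) of the lemma as `∂ₜπ + (u + 2x'/|x'|²)·∇π - Δπ ≤ 0` (SUBsolutions) and `hWH`
renders it verbatim. This file supplies the explicit profile used by the sibling
`…Lemma22RenderedSign` to show that with this sign the lemma is false: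

* calculus of `Φ_L(x) = exp(-L(x₀² + x₁²))` on `ℝ³` — `hasFDerivAt_gaussX`, `fderiv_gaussX_apply`,
  `fderiv_fderiv_gaussX_apply` (pure second derivatives), `laplacian_gaussX`
  (`ΔΦ_L = e^{-Lϱ²}(4L²ϱ² - 4L)`), `two_div_mul_fderiv_gaussX_eR` (`(2/ϱ)∂_ϱΦ_L = -4L e^{-Lϱ²}`);
* `gaussX_deriv_bounds` — the class-𝒱 (ii) bounds `‖DΦ_L‖ ≤ 4Lρ`, `|∂ₑ∂ₑΦ_L| ≤ 16L²ρ² + 4L` on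
  `{ϱ < ρ}`;
* `gaussX_subsolution` — off the axis `DΦ_L[0] + (2/ϱ)∂_ϱΦ_L - ΔΦ_L = -4L²ϱ²e^{-Lϱ²} ≤ 0`: with
  zero velocity, `Φ_L` satisfies (2.12) AS PRINTED. (For `Φ = h(ϱ²)` the quantity is `-4ϱ²h''(ϱ²)`;
  the operator `∂²_ϱ - ϱ⁻¹∂_ϱ + ∂²₃` is that of `Γ = ϱu_φ`, whose kernel contains `ϱ²`.)

## References

* G. Seregin, Anal. Math. Phys. 10 (2020), Paper 46 = arXiv:2006.04140, Lemma 2.2, (2.12)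
  (arXiv p. 8). [Seregin2020]
-/

-- the problem directory repeats the summit name (D-0017); core's `dupNamespace` linter fires
set_option linter.dupNamespace false

noncomputable section

open MeasureTheory Set Function Filter Topology TopologicalSpace Metric WithLp
open scoped NNReal ENNReal Laplacian

namespace Summit.NavierStokesRegularity.NavierStokesRegularity.Theorems.AxisymmetricKatoGlobal.EulerScaling

open Literature.Analysis.FluidPDE

/-! ### Calculus of the profile `x ↦ exp(-L(x₀² + x₁²))` -/

/-- The derivative of the planar Gaussian `y ↦ exp(-L(y₀² + y₁²))` on `ℝ³`:
`D(x) = e^{-L(x₀²+x₁²)} · (-(L · (2x₀ dy₀ + 2x₁ dy₁)))`. [folklore] -/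
theorem hasFDerivAt_gaussX (L : ℝ) (x : EuclideanSpace ℝ (Fin 3)) :
    HasFDerivAt (fun y : EuclideanSpace ℝ (Fin 3) => Real.exp (-(L * (y 0 ^ 2 + y 1 ^ 2))))
      (Real.exp (-(L * (x 0 ^ 2 + x 1 ^ 2))) •
        -(L • ((2 * x 0) • (EuclideanSpace.proj (0 : Fin 3) : EuclideanSpace ℝ (Fin 3) →L[ℝ] ℝ) +
          (2 * x 1) • (EuclideanSpace.proj (1 : Fin 3) : EuclideanSpace ℝ (Fin 3) →L[ℝ] ℝ)))) x := by
  have hq := hasFDerivAt_cylRadius_sq x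
  have e : (fun y : EuclideanSpace ℝ (Fin 3) => cylRadius y ^ 2) = fun y => y 0 ^ 2 + y 1 ^ 2 :=
    funext cylRadius_sq
  rw [e] at hq
  have h1 : HasFDerivAt (fun y : EuclideanSpace ℝ (Fin 3) => -(L * (y 0 ^ 2 + y 1 ^ 2)))
      (-(L • ((2 * x 0) • (EuclideanSpace.proj (0 : Fin 3) : EuclideanSpace ℝ (Fin 3) →L[ℝ] ℝ) +
          (2 * x 1) • (EuclideanSpace.proj (1 : Fin 3) : EuclideanSpace ℝ (Fin 3) →L[ℝ] ℝ)))) x :=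
    (hq.const_mul L).neg
  exact h1.exp

/-- The directional derivative of the planar Gaussian:
`D(e^{-L(y₀²+y₁²)})(x)[v] = e^{-L(x₀²+x₁²)} · (-L(2x₀v₀ + 2x₁v₁))`. [folklore] -/
theorem fderiv_gaussX_apply (L : ℝ) (x v : EuclideanSpace ℝ (Fin 3)) :
    fderiv ℝ (fun y : EuclideanSpace ℝ (Fin 3) => Real.exp (-(L * (y 0 ^ 2 + y 1 ^ 2)))) x v =
      Real.exp (-(L * (x 0 ^ 2 + x 1 ^ 2))) * (-L * (2 * x 0 * v 0 + 2 * x 1 * v 1)) := by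
  rw [(hasFDerivAt_gaussX L x).fderiv]
  simp [smul_eq_mul]
  ring

/-- The directional derivative of the planar Gaussian as a function of the base point. [folklore] -/
theorem fderiv_gaussX_eq (L : ℝ) (v : EuclideanSpace ℝ (Fin 3)) :
    (fun y : EuclideanSpace ℝ (Fin 3) => fderiv ℝ (fun y : EuclideanSpace ℝ (Fin 3) =>
        Real.exp (-(L * (y 0 ^ 2 + y 1 ^ 2)))) y v) =
      fun y => Real.exp (-(L * (y 0 ^ 2 + y 1 ^ 2))) * (-L * (2 * y 0 * v 0 + 2 * y 1 * v 1)) :=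
  funext fun y => fderiv_gaussX_apply L y v

/-- The pure second derivative of the planar Gaussian along `e`:
`∂ₑ∂ₑ(e^{-L(y₀²+y₁²)})(x) = e^{-L(x₀²+x₁²)} ((L(2x₀e₀ + 2x₁e₁))² - L(2e₀² + 2e₁²))`. [folklore] -/
theorem fderiv_fderiv_gaussX_apply (L : ℝ) (x e : EuclideanSpace ℝ (Fin 3)) :
    fderiv ℝ (fun y : EuclideanSpace ℝ (Fin 3) => fderiv ℝ (fun y : EuclideanSpace ℝ (Fin 3) =>
        Real.exp (-(L * (y 0 ^ 2 + y 1 ^ 2)))) y e) x e =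
      Real.exp (-(L * (x 0 ^ 2 + x 1 ^ 2))) *
        ((L * (2 * x 0 * e 0 + 2 * x 1 * e 1)) ^ 2 - L * (2 * e 0 * e 0 + 2 * e 1 * e 1)) := by
  rw [fderiv_gaussX_eq L e]
  have hlin : HasFDerivAt (fun y : EuclideanSpace ℝ (Fin 3) => -L * (2 * y 0 * e 0 + 2 * y 1 * e 1))
      ((-L * (2 * e 0)) • (EuclideanSpace.proj (0 : Fin 3) : EuclideanSpace ℝ (Fin 3) →L[ℝ] ℝ) +
        (-L * (2 * e 1)) • (EuclideanSpace.proj (1 : Fin 3) : EuclideanSpace ℝ (Fin 3) →L[ℝ] ℝ)) x := by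
    have h0 : HasFDerivAt (fun y : EuclideanSpace ℝ (Fin 3) => y 0)
        (EuclideanSpace.proj (0 : Fin 3) : EuclideanSpace ℝ (Fin 3) →L[ℝ] ℝ) x :=
      (EuclideanSpace.proj (0 : Fin 3) : EuclideanSpace ℝ (Fin 3) →L[ℝ] ℝ).hasFDerivAt
    have h1 : HasFDerivAt (fun y : EuclideanSpace ℝ (Fin 3) => y 1)
        (EuclideanSpace.proj (1 : Fin 3) : EuclideanSpace ℝ (Fin 3) →L[ℝ] ℝ) x :=
      (EuclideanSpace.proj (1 : Fin 3) : EuclideanSpace ℝ (Fin 3) →L[ℝ] ℝ).hasFDerivAt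
    have h := (h0.const_mul (-L * (2 * e 0))).add (h1.const_mul (-L * (2 * e 1)))
    refine h.congr_of_eventuallyEq (Eventually.of_forall fun y => ?_)
    simp only [Pi.add_apply]
    ring
  have h : HasFDerivAt (fun y : EuclideanSpace ℝ (Fin 3) =>
      Real.exp (-(L * (y 0 ^ 2 + y 1 ^ 2))) * (-L * (2 * y 0 * e 0 + 2 * y 1 * e 1))) _ x :=
    (hasFDerivAt_gaussX L x).mul hlin
  rw [h.fderiv]
  simp [smul_eq_mul]
  ring

/-- The Laplacian of the planar Gaussian on `ℝ³`:
`Δ(e^{-L(y₀²+y₁²)})(x) = e^{-L(x₀²+x₁²)} (4L²(x₀² + x₁²) - 4L)` (the planar radial formula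
`Δ(g(|y'|²)) = 4|y'|²g'' + 4g'` transported by the horizontal projection,
`laplacian_comp_horizProj`, `laplacian_comp_norm_sq`). [folklore] -/
theorem laplacian_gaussX (L : ℝ) (x : EuclideanSpace ℝ (Fin 3)) :
    (Δ (fun y : EuclideanSpace ℝ (Fin 3) => Real.exp (-(L * (y 0 ^ 2 + y 1 ^ 2))))) x =
      Real.exp (-(L * (x 0 ^ 2 + x 1 ^ 2))) * (4 * L ^ 2 * (x 0 ^ 2 + x 1 ^ 2) - 4 * L) := by
  obtain ⟨P, hP⟩ := exists_horizProj
  set g : ℝ → ℝ := fun s => Real.exp (-(L * s)) with hg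
  set g₁ : ℝ → ℝ := fun s => Real.exp (-(L * s)) * -L with hg₁
  have hfun : (fun y : EuclideanSpace ℝ (Fin 3) => Real.exp (-(L * (y 0 ^ 2 + y 1 ^ 2)))) =
      fun y => (fun z : EuclideanSpace ℝ (Fin 2) => g (‖z‖ ^ 2)) (P y) := by
    funext y
    simp only [hg, norm_sq_horizProj hP]
  have hgd : ∀ s ∈ (univ : Set ℝ), HasDerivAt g (g₁ s) s := fun s _ => by
    have h := ((hasDerivAt_id s).const_mul L).neg.exp
    simpa [hg, hg₁] using h
  have hg2 : ContDiff ℝ 2 fun z : EuclideanSpace ℝ (Fin 2) => g (‖z‖ ^ 2) :=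
    Real.contDiff_exp.comp ((contDiff_const.mul (contDiff_norm_sq ℝ)).neg)
  rw [hfun, laplacian_comp_horizProj hP hg2]
  have hg₁d : HasDerivAt g₁ (Real.exp (-(L * ‖P x‖ ^ 2)) * -L * -L) (‖P x‖ ^ 2) := by
    have h := (((hasDerivAt_id (‖P x‖ ^ 2)).const_mul L).neg.exp).mul_const (-L)
    simpa [hg₁] using h
  rw [laplacian_comp_norm_sq isOpen_univ hgd (mem_univ _) hg₁d, finrank_euclideanSpace,
    Fintype.card_fin, norm_sq_horizProj hP]
  simp only [hg₁]
  push_cast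
  ring

/-- The drift term of (2.12) for the planar Gaussian off the axis:
`(2/ϱ) ∂_ϱ(e^{-L(y₀²+y₁²)})(x) = -4L e^{-L(x₀²+x₁²)}` (`∂_ϱ = D(·)[e_ϱ]`, `e_ϱ = x'/ϱ`). [folklore] -/
theorem two_div_mul_fderiv_gaussX_eR (L : ℝ) {x : EuclideanSpace ℝ (Fin 3)} (hx : cylRadius x ≠ 0) :
    2 / cylRadius x * fderiv ℝ (fun y : EuclideanSpace ℝ (Fin 3) =>
        Real.exp (-(L * (y 0 ^ 2 + y 1 ^ 2)))) x (eR x) =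
      -(4 * L) * Real.exp (-(L * (x 0 ^ 2 + x 1 ^ 2))) := by
  rw [fderiv_gaussX_apply]
  have h0 : eR x 0 = (cylRadius x)⁻¹ * x 0 := by simp [eR]
  have h1 : eR x 1 = (cylRadius x)⁻¹ * x 1 := by simp [eR]
  rw [h0, h1]
  have hq : x 0 ^ 2 + x 1 ^ 2 = cylRadius x ^ 2 := (cylRadius_sq x).symm
  field_simp
  rw [hq]
  ring

/-- The planar Gaussian is at most `1` for `L ≥ 0`. [folklore] -/
theorem gaussX_le_one {L : ℝ} (hL : 0 ≤ L) (x : EuclideanSpace ℝ (Fin 3)) :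
    Real.exp (-(L * (x 0 ^ 2 + x 1 ^ 2))) ≤ 1 := by
  rw [Real.exp_le_one_iff, neg_nonpos]
  positivity

/-- An elementary bound: `|2ac + 2bd| ≤ 4ρs` when `|a|, |b| ≤ ρ` and `|c|, |d| ≤ s`. [folklore] -/
theorem abs_two_mul_add_two_mul_le {a b c d ρ s : ℝ} (ha : |a| ≤ ρ) (hb : |b| ≤ ρ) (hc : |c| ≤ s)
    (hd : |d| ≤ s) (hρ : 0 ≤ ρ) : |2 * a * c + 2 * b * d| ≤ 4 * ρ * s := by
  have hs : 0 ≤ s := (abs_nonneg c).trans hc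
  calc |2 * a * c + 2 * b * d| ≤ |2 * a * c| + |2 * b * d| := abs_add_le _ _
    _ = 2 * (|a| * |c|) + 2 * (|b| * |d|) := by simp only [abs_mul, abs_two]; ring
    _ ≤ 2 * (ρ * s) + 2 * (ρ * s) := by
        gcongr
    _ = 4 * ρ * s := by ring

/-- Bounds of the first and of the pure second derivatives of the planar Gaussian on
`{ϱ < ρ}` (`L ≥ 0`): `‖D‖ ≤ 4Lρ`, `|∂ₑ∂ₑ| ≤ 16L²ρ² + 4L` for `‖e‖ ≤ 1`. [folklore] -/
theorem gaussX_deriv_bounds : ∀ (L ρ : ℝ), 0 ≤ L → 0 ≤ ρ → ∀ x : EuclideanSpace ℝ (Fin 3),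
    cylRadius x < ρ →
    ‖fderiv ℝ (fun y : EuclideanSpace ℝ (Fin 3) => Real.exp (-(L * (y 0 ^ 2 + y 1 ^ 2)))) x‖ ≤ 4 * L * ρ ∧
      ∀ e : EuclideanSpace ℝ (Fin 3), ‖e‖ ≤ 1 →
        |fderiv ℝ (fun y : EuclideanSpace ℝ (Fin 3) => fderiv ℝ (fun y : EuclideanSpace ℝ (Fin 3) =>
          Real.exp (-(L * (y 0 ^ 2 + y 1 ^ 2)))) y e) x e| ≤ 16 * L ^ 2 * ρ ^ 2 + 4 * L := by
  intro L ρ hL hρ x hx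
  have hE : 0 < Real.exp (-(L * (x 0 ^ 2 + x 1 ^ 2))) := Real.exp_pos _
  have hE1 : Real.exp (-(L * (x 0 ^ 2 + x 1 ^ 2))) ≤ 1 := gaussX_le_one hL x
  have hx0 : |x 0| ≤ ρ := (Real.abs_le_sqrt (by nlinarith [sq_nonneg (x 1)])).trans hx.le
  have hx1 : |x 1| ≤ ρ := (Real.abs_le_sqrt (by nlinarith [sq_nonneg (x 0)])).trans hx.le
  refine ⟨ContinuousLinearMap.opNorm_le_bound _ (by positivity) fun v => ?_, fun e he => ?_⟩
  · rw [fderiv_gaussX_apply, Real.norm_eq_abs, abs_mul, abs_of_pos hE]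
    have hv0 : |v 0| ≤ ‖v‖ := by simpa using PiLp.norm_apply_le v 0
    have hv1 : |v 1| ≤ ‖v‖ := by simpa using PiLp.norm_apply_le v 1
    have hlin := abs_two_mul_add_two_mul_le hx0 hx1 hv0 hv1 hρ
    have h1 : |(-L) * (2 * x 0 * v 0 + 2 * x 1 * v 1)| ≤ 4 * L * ρ * ‖v‖ := by
      rw [abs_mul, abs_neg, abs_of_nonneg hL]
      nlinarith
    calc Real.exp (-(L * (x 0 ^ 2 + x 1 ^ 2))) * |(-L) * (2 * x 0 * v 0 + 2 * x 1 * v 1)|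
        ≤ 1 * (4 * L * ρ * ‖v‖) := mul_le_mul hE1 h1 (abs_nonneg _) zero_le_one
      _ = 4 * L * ρ * ‖v‖ := one_mul _
  · rw [fderiv_fderiv_gaussX_apply, abs_mul, abs_of_pos hE]
    have he0 : |e 0| ≤ 1 := by simpa using (PiLp.norm_apply_le e 0).trans he
    have he1 : |e 1| ≤ 1 := by simpa using (PiLp.norm_apply_le e 1).trans he
    have hlin := abs_two_mul_add_two_mul_le hx0 hx1 he0 he1 hρ
    have hsq : (L * (2 * x 0 * e 0 + 2 * x 1 * e 1)) ^ 2 ≤ 16 * L ^ 2 * ρ ^ 2 := by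
      have h2 : (2 * x 0 * e 0 + 2 * x 1 * e 1) ^ 2 ≤ (4 * ρ * 1) ^ 2 := by
        rw [← sq_abs (2 * x 0 * e 0 + 2 * x 1 * e 1)]
        exact pow_le_pow_left₀ (abs_nonneg _) hlin 2
      nlinarith [sq_nonneg L]
    have hee : 2 * e 0 * e 0 + 2 * e 1 * e 1 ≤ 4 := by
      have h0' : e 0 ^ 2 ≤ 1 := by
        have := pow_le_pow_left₀ (abs_nonneg _) he0 2
        simpa [sq_abs] using this
      have h1' : e 1 ^ 2 ≤ 1 := by
        have := pow_le_pow_left₀ (abs_nonneg _) he1 2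
        simpa [sq_abs] using this
      nlinarith
    have hee0 : 0 ≤ 2 * e 0 * e 0 + 2 * e 1 * e 1 := by nlinarith [sq_nonneg (e 0), sq_nonneg (e 1)]
    have habs : |(L * (2 * x 0 * e 0 + 2 * x 1 * e 1)) ^ 2 - L * (2 * e 0 * e 0 + 2 * e 1 * e 1)| ≤
        16 * L ^ 2 * ρ ^ 2 + 4 * L := by
      rw [abs_le]
      constructor
      · nlinarith [sq_nonneg (L * (2 * x 0 * e 0 + 2 * x 1 * e 1)), mul_nonneg hL hee0, sq_nonneg L, sq_nonneg ρ]
      · nlinarith [mul_nonneg hL hee0]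
    calc Real.exp (-(L * (x 0 ^ 2 + x 1 ^ 2))) *
          |(L * (2 * x 0 * e 0 + 2 * x 1 * e 1)) ^ 2 - L * (2 * e 0 * e 0 + 2 * e 1 * e 1)|
        ≤ 1 * (16 * L ^ 2 * ρ ^ 2 + 4 * L) := mul_le_mul hE1 habs (abs_nonneg _) zero_le_one
      _ = 16 * L ^ 2 * ρ ^ 2 + 4 * L := one_mul _

/-- **The planar Gaussian is a classical SUBsolution of (2.12) with zero velocity**: off the axis
`D(Φ)(x)[0] + (2/ϱ)∂_ϱΦ(x) - ΔΦ(x) = -4L²(x₀² + x₁²) e^{-L(x₀²+x₁²)} ≤ 0` — the sign printed in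
Seregin 2020, (2.12). (For `Φ = h(ϱ²)` the quantity is `-4ϱ²h''(ϱ²)`: every convex profile of `ϱ²`
is a subsolution.) [cite: Seregin2020, Lemma 2.2, (2.12) (arXiv p. 8)] -/
theorem gaussX_subsolution : ∀ (L : ℝ) (x : EuclideanSpace ℝ (Fin 3)), cylRadius x ≠ 0 →
    fderiv ℝ (fun y : EuclideanSpace ℝ (Fin 3) => Real.exp (-(L * (y 0 ^ 2 + y 1 ^ 2)))) x 0 +
        2 / cylRadius x * partialDeriv (eR x) (fun y : EuclideanSpace ℝ (Fin 3) =>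
          Real.exp (-(L * (y 0 ^ 2 + y 1 ^ 2)))) x -
        (Laplacian.laplacian (fun y : EuclideanSpace ℝ (Fin 3) =>
          Real.exp (-(L * (y 0 ^ 2 + y 1 ^ 2))))) x ≤ 0 := by
  intro L x hx
  rw [map_zero, partialDeriv, two_div_mul_fderiv_gaussX_eR L hx, laplacian_gaussX]
  have hE : 0 < Real.exp (-(L * (x 0 ^ 2 + x 1 ^ 2))) := Real.exp_pos _
  have hq : 0 ≤ x 0 ^ 2 + x 1 ^ 2 := by positivity
  nlinarith [mul_nonneg (mul_nonneg (sq_nonneg L) hq) hE.le]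

end Summit.NavierStokesRegularity.NavierStokesRegularity.Theorems.AxisymmetricKatoGlobal.EulerScaling

end
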